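import Summits.QuantumFields.YangMills.Theorems.FluctuationComparisonRegPrIntLOddsLedgerVers
import HarnessLib

/-!
# `FluctuationComparisonRegPrIntLSupTailReduction` — LINE g21-1 «SUP-TAIL × CRUDE LOCALITY»: THE MEASURE-LEVEL DOOR OF TAILSUP
# (crux `UnitScaleTilt.FluctuationComparisonRegPrIntL`, stmt-QuantumFields-20520; row TAILSUP `WindowOddsSupCan` and its first rung TAILSUP₁
# `WindowOddsSupDepthOneCan` of `Cruxes/FluctuationComparisonRegPrIntL/Lines/suptail_split.lean` v1, ideator ym-r3-idea-1 g21)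

Cell `ym3-torus` (YM ladder rung R3 = continuum SU(2) Yang–Mills on T³ — a RUNG, NOT the Clay problem: not d = 4, not infinite volume, not a mass gap);
width seat `ym-ust-20520-w3` (gen 17, the LEAD-20520 width seat); helper `--supports stmt-QuantumFields-20520`.  THEOREMS ONLY (0 `def`, 0 `sorry`, default heartbeats).

WHAT.  TAILSUP says: for every continuous positive window version `ρ` of the nested law `ν_{K,J}` the log-ratio `log ρ − c − log heightDensityCan^{histGood}`
has oscillation `≤ τ_J` over the window `W_J = {PlaqSmall θ_J}`, `τ_J` super-polynomially small.  Its reading (line card): `= −log P(history good ∣ V_J = U)`.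
This file PROVES that reading as a DOOR: TAILSUP (text verbatim, `heightDensityCan` = ✓`…WregGlue.heightDensityCan`, so the line closes its stub by `delta`)
follows from ONE SETWISE INEQUALITY FOR THE GIBBS MEASURE ITSELF — no density, no version, no chart:
  COND-ODDS  `∀ B ⊆ W_J measurable, Gibbs_K(D_{J,K}⁻¹B) ≤ e^{τ_J}·Gibbs_K(D_{J,K}⁻¹B ∩ histGood K J)`
(«conditionally on the window σ-algebra the good-history odds are ≥ e^{−τ_J}»), `D_{J,K} = descendTo` the `K − J` averagings read at height `J`.
* §1 `le_on_of_ae_le` — on an open set, an a.e. inequality between two functions continuous there holds EVERYWHERE (`IsOpenPosMeasure`; via Mathlib's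
  `Measure.eqOn_open_of_ae_eq` applied to `min f g`).
* §2 ★`heightDensity_ae_le_of_setwise` — a setwise inequality `Gibbs(D⁻¹B ∩ S) ≤ C·Gibbs(D⁻¹B ∩ S')` on the window IS the a.e. inequality
  `heightDensity^{S} ≤ C·heightDensity^{S'}` on the window (✓`map_descendTo_restrict_eq_withDensity`: both laws are `dU·Z_K⁻¹heightDensity^{·}`;
  `ae_le_of_forall_setLIntegral_le_of_sigmaFinite`); ★`heightDensityCan_le_of_setwise` — the same for the CANONICAL versions, pointwise on the window, given their
  continuity there (§1 + ✓`canonVersion_ae_eq`).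
* §3 ★`heightDensityCan_univ_eqOn` — the full density's canonical version IS `Z_K·ρ` on the window (VERS ✓p752318's two-presentation argument, re-run to export the
  `EqOn`); ★★`window_logOdds_bounds` — COND-ODDS at one `(J, K)` + window ⊆ `regSet(heightDensity^{histGood})` + positivity ⇒ `0 ≤ log ρ − (−log Z_K) − log q^{hist}_can ≤ τ`
  on the window (the lower half is FREE: `Gibbs(D⁻¹B ∩ hist) ≤ Gibbs(D⁻¹B)`).
* §4 ★★★`windowOddsSupCan_of_condGoodOdds : ⟨COND-ODDS⟩ → ⟨TAILSUP verbatim⟩` and ★★`windowOddsSupDepthOneCan_of_condGoodOddsDepthOne` (the `K = J + 1` instances ⇒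
  TAILSUP₁ verbatim); WREG ✓`windowRegularity` supplies the `regSet` clause (thresholds `min γ₁`).
* The modulus side (bad fraction ⇒ COND-ODDS's shape, print's per-plaquette currency ⇒ `τ J ≤ A'·2^{−J}`, super-polynomial smallness) is the companion
  file `…SupTailModulus` (independent imports).
HONEST SCOPE.  Measure-theoretic bookkeeping; the large-deviation content of TAILSUP (COND-ODDS) is the HYPOTHESIS.  TAILSUP, TAILSUP₁, CRUDELOC, LFR♯ᶜ, S2β,
`FluctuationComparisonRegPrIntL` 20520 and `YM3TorusSU2` are NOT proved; no summit statement is proved; the Yang–Mills mass gap is NOT proved.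
References: [Balaban1985UV3] (2) p. 256, (6)–(7) p. 257, (38)–(40) p. 266; [Balaban1989LargeFieldII] (1.77)–(1.79) p. 383; [Balaban1987RG1] (0.11) p. 253.
-/

noncomputable section

set_option autoImplicit false

open MeasureTheory Filter Topology Set
open scoped ENNReal NNReal BigOperators
open Literature.MathematicalPhysics.QuantumFieldTheory.Balaban1983to89
open Literature.MathematicalPhysics.QuantumFieldTheory.Balaban1983to89.T3ContinuumYM3Torus
open Literature.MathematicalPhysics.QuantumFieldTheory.Balaban1983to89.T3NestedUnitLaws
open Literature.MathematicalPhysics.QuantumFieldTheory.Balaban1983to89.T3UnitLawDensityEML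
open Literature.MathematicalPhysics.QuantumFieldTheory.Balaban1983to89.T3UnitScaleTilt
open Literature.MathematicalPhysics.QuantumFieldTheory.Balaban1983to89.T3TiltDescent
open Literature.MathematicalPhysics.QuantumFieldTheory.Balaban1983to89.Missing
open scoped Literature.MathematicalPhysics.QuantumFieldTheory.Balaban1983to89.T3OrbitAverage
open Summit.QuantumFields.YangMills.Theorems.FluctuationComparisonRegPrIntLWregGlue (heightDensityCan)
open Summit.QuantumFields.YangMills.Theorems.FluctuationComparisonRegPrIntLWregAssembly (isOpen_setOf_plaqSmall₂)
open Summit.QuantumFields.YangMills.Theorems.FluctuationComparisonRegPrIntLOddsLedgerVers (tower_eq_map_descendTo)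

namespace Summit.QuantumFields.YangMills.Theorems.FluctuationComparisonRegPrIntLSupTailReduction

/-! ## §1 An a.e. inequality between functions continuous on an open set holds everywhere on it -/

/-- On an open set `U`, for a measure positive on non-empty open sets: if `f ≤ g` a.e. on `U` and both are continuous on `U`, then `f ≤ g` at EVERY point of `U`
(apply `Measure.eqOn_open_of_ae_eq` to `min f g` and `f`). [folklore] -/
theorem le_on_of_ae_le {X : Type*} [TopologicalSpace X] [MeasurableSpace X] {μ : Measure X} [μ.IsOpenPosMeasure] {U : Set X} (hU : IsOpen U)
    {f g : X → ℝ} (hf : ContinuousOn f U) (hg : ContinuousOn g U) (h : ∀ᵐ x ∂μ.restrict U, f x ≤ g x) : ∀ x ∈ U, f x ≤ g x := by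
  have hmin : ContinuousOn (fun x => f x ⊓ g x) U := hf.inf hg
  have hae : (fun x => f x ⊓ g x) =ᵐ[μ.restrict U] f := by
    filter_upwards [h] with x hx using inf_eq_left.mpr hx
  have hEq : EqOn (fun x => f x ⊓ g x) f U := Measure.eqOn_open_of_ae_eq hae hU hmin hf
  intro x hx
  have hx' : f x ⊓ g x = f x := hEq hx
  rw [← hx']
  exact inf_le_right

/-! ## §2 A setwise Gibbs inequality on the window IS an inequality of the height densities there -/

section Setwise

variable (F : T3Family) {γ : ℝ} {J K : ℕ} (hJK : J ≤ K)

/-- ★ **SETWISE ⇒ ALMOST EVERYWHERE**: if on the measurable subsets `B` of a measurable set `W` of height-`J` fields the run-`K` Gibbs masses satisfy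
`Gibbs_K(D⁻¹B ∩ S) ≤ C·Gibbs_K(D⁻¹B ∩ S')` (`D = descendTo J K`), then `heightDensity^{S} ≤ C·heightDensity^{S'}` product-Haar-a.e. on `W` — both descended
restricted laws are `dU·Z_K⁻¹heightDensity^{·}` (✓`map_descendTo_restrict_eq_withDensity`). [cite: Balaban1985UV3, (2) p.256 and (6) p.257] -/
theorem heightDensity_ae_le_of_setwise (hγ : 0 < γ) {S S' : Set (GaugeField (F.P K) 0 (Matrix.specialUnitaryGroup (Fin 2) ℂ))} (hS : MeasurableSet S)
    (hS' : MeasurableSet S') {W : Set (GaugeField (F.P J) 0 (Matrix.specialUnitaryGroup (Fin 2) ℂ))} (hW : MeasurableSet W) {C : ℝ} (hC : 0 ≤ C)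
    (hset : ∀ B : Set (GaugeField (F.P J) 0 (Matrix.specialUnitaryGroup (Fin 2) ℂ)), MeasurableSet B → B ⊆ W →
      gibbsK F ℰp γ K (descendTo F ℰp J K hJK ⁻¹' B ∩ S) ≤ ENNReal.ofReal C * gibbsK F ℰp γ K (descendTo F ℰp J K hJK ⁻¹' B ∩ S')) :
    ∀ᵐ U ∂(fieldMeasure (F.P J) 0 (Matrix.specialUnitaryGroup (Fin 2) ℂ)).restrict W,
      heightDensity F γ hJK S U ≤ C * heightDensity F γ hJK S' U := by
  set μ := fieldMeasure (F.P J) 0 (Matrix.specialUnitaryGroup (Fin 2) ℂ) with hμ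
  set Z : ℝ := partitionFn (G := Matrix.specialUnitaryGroup (Fin 2) ℂ) (F.P K) ((F.scheme ℰp γ).β K) with hZ
  have hZpos : 0 < Z := partitionFn_pos' _ (F.scheme_β_nonneg ℰp hγ.le K)
  have hD : Measurable (descendTo F ℰp J K hJK) := measurable_descendTo F ℰp measurableE_ℰp hJK
  obtain ⟨hmS, -⟩ := heightDensity_props F hJK (S := S) hS hγ.le
  obtain ⟨hmS', -⟩ := heightDensity_props F hJK (S := S') hS' hγ.le
  -- the two descended restricted laws as densities
  have hlawS := map_descendTo_restrict_eq_withDensity F hJK hS hγ.le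
  have hlawS' := map_descendTo_restrict_eq_withDensity F hJK hS' hγ.le
  -- set function identities
  have happly : ∀ {T : Set (GaugeField (F.P K) 0 (Matrix.specialUnitaryGroup (Fin 2) ℂ))} (hT : MeasurableSet T)
      (B : Set (GaugeField (F.P J) 0 (Matrix.specialUnitaryGroup (Fin 2) ℂ))), MeasurableSet B →
      Measure.map (descendTo F ℰp J K hJK) ((gibbsK F ℰp γ K).restrict T) B = gibbsK F ℰp γ K (descendTo F ℰp J K hJK ⁻¹' B ∩ T) := by
    intro T hT B hB
    rw [Measure.map_apply hD hB, Measure.restrict_apply (hD hB)]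
  set f : GaugeField (F.P J) 0 (Matrix.specialUnitaryGroup (Fin 2) ℂ) → ℝ≥0∞ := fun U => ENNReal.ofReal (Z⁻¹ * heightDensity F γ hJK S U) with hf
  set g : GaugeField (F.P J) 0 (Matrix.specialUnitaryGroup (Fin 2) ℂ) → ℝ≥0∞ := fun U => ENNReal.ofReal (Z⁻¹ * heightDensity F γ hJK S' U) with hg
  have hfm : Measurable f := (hmS.const_mul _).ennreal_ofReal
  have hgm : Measurable g := (hmS'.const_mul _).ennreal_ofReal
  -- the setwise inequality in `lintegral` form on `μ.restrict W`
  have hint : ∀ B : Set (GaugeField (F.P J) 0 (Matrix.specialUnitaryGroup (Fin 2) ℂ)), MeasurableSet B → (μ.restrict W) B < ∞ →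
      ∫⁻ U in B, f U ∂(μ.restrict W) ≤ ∫⁻ U in B, (fun U => ENNReal.ofReal C * g U) U ∂(μ.restrict W) := by
    intro B hB _
    rw [Measure.restrict_restrict hB, lintegral_const_mul _ hgm]
    have h1 : ∫⁻ U in B ∩ W, f U ∂μ = gibbsK F ℰp γ K (descendTo F ℰp J K hJK ⁻¹' (B ∩ W) ∩ S) := by
      rw [← happly hS (B ∩ W) (hB.inter hW), hlawS, withDensity_apply _ (hB.inter hW)]
    have h2 : ∫⁻ U in B ∩ W, g U ∂μ = gibbsK F ℰp γ K (descendTo F ℰp J K hJK ⁻¹' (B ∩ W) ∩ S') := by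
      rw [← happly hS' (B ∩ W) (hB.inter hW), hlawS', withDensity_apply _ (hB.inter hW)]
    rw [h1, h2]
    exact hset (B ∩ W) (hB.inter hW) Set.inter_subset_right
  haveI : SigmaFinite (μ.restrict W) := by rw [hμ]; infer_instance
  have hae : f ≤ᵐ[μ.restrict W] fun U => ENNReal.ofReal C * g U := ae_le_of_forall_setLIntegral_le_of_sigmaFinite hfm hint
  filter_upwards [hae] with U hU
  have h0 : 0 ≤ Z⁻¹ * heightDensity F γ hJK S' U := mul_nonneg (inv_nonneg.mpr hZpos.le) (heightDensity_nonneg F γ hJK _ U)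
  have hU' : ENNReal.ofReal (Z⁻¹ * heightDensity F γ hJK S U) ≤ ENNReal.ofReal (C * (Z⁻¹ * heightDensity F γ hJK S' U)) := by
    have := hU
    simp only [hf, hg] at this
    rwa [← ENNReal.ofReal_mul hC] at this
  have hreal : Z⁻¹ * heightDensity F γ hJK S U ≤ C * (Z⁻¹ * heightDensity F γ hJK S' U) :=
    (ENNReal.ofReal_le_ofReal_iff (mul_nonneg hC h0)).mp hU'
  have := mul_le_mul_of_nonneg_left hreal hZpos.le
  calc heightDensity F γ hJK S U = Z * (Z⁻¹ * heightDensity F γ hJK S U) := by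
        rw [← mul_assoc, mul_inv_cancel₀ hZpos.ne', one_mul]
    _ ≤ Z * (C * (Z⁻¹ * heightDensity F γ hJK S' U)) := this
    _ = C * heightDensity F γ hJK S' U := by
        rw [mul_left_comm, ← mul_assoc Z, mul_inv_cancel₀ hZpos.ne', one_mul]

/-- ★ **SETWISE ⇒ POINTWISE FOR THE CANONICAL VERSIONS ON AN OPEN WINDOW**: under the setwise inequality of `heightDensity_ae_le_of_setwise` on an OPEN `W`, if
both canonical versions are continuous on `W` then `heightDensityCan^{S} ≤ C·heightDensityCan^{S'}` at EVERY point of `W` (✓`canonVersion_ae_eq`, §1, product Haar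
is positive on open sets). [cite: Balaban1985UV3, (2) p.256 and (6) p.257; Balaban1987RG1, (0.13) p.254] -/
theorem heightDensityCan_le_of_setwise (hγ : 0 < γ) {S S' : Set (GaugeField (F.P K) 0 (Matrix.specialUnitaryGroup (Fin 2) ℂ))} (hS : MeasurableSet S)
    (hS' : MeasurableSet S') {W : Set (GaugeField (F.P J) 0 (Matrix.specialUnitaryGroup (Fin 2) ℂ))} (hW : IsOpen W) {C : ℝ} (hC : 0 ≤ C)
    (hset : ∀ B : Set (GaugeField (F.P J) 0 (Matrix.specialUnitaryGroup (Fin 2) ℂ)), MeasurableSet B → B ⊆ W →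
      gibbsK F ℰp γ K (descendTo F ℰp J K hJK ⁻¹' B ∩ S) ≤ ENNReal.ofReal C * gibbsK F ℰp γ K (descendTo F ℰp J K hJK ⁻¹' B ∩ S'))
    (hcS : ContinuousOn (heightDensityCan F γ hJK S) W) (hcS' : ContinuousOn (heightDensityCan F γ hJK S') W) :
    ∀ U ∈ W, heightDensityCan F γ hJK S U ≤ C * heightDensityCan F γ hJK S' U := by
  haveI := B12ContinuousTransportInvariance.isOpenPosMeasure_fieldMeasure_SU (N := 2) (F.P J) 0
  set μ := fieldMeasure (F.P J) 0 (Matrix.specialUnitaryGroup (Fin 2) ℂ) with hμ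
  have hae := heightDensity_ae_le_of_setwise F hJK hγ hS hS' hW.measurableSet hC hset
  have h1 : heightDensityCan F γ hJK S =ᵐ[μ.restrict W] heightDensity F γ hJK S := ae_restrict_of_ae Node00.canonVersion_ae_eq
  have h2 : heightDensityCan F γ hJK S' =ᵐ[μ.restrict W] heightDensity F γ hJK S' := ae_restrict_of_ae Node00.canonVersion_ae_eq
  have hae' : ∀ᵐ U ∂μ.restrict W, heightDensityCan F γ hJK S U ≤ C * heightDensityCan F γ hJK S' U := by
    filter_upwards [hae, h1, h2] with U hU hU1 hU2
    rw [hU1, hU2]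
    exact hU
  exact le_on_of_ae_le hW hcS (continuousOn_const.mul hcS') hae'

end Setwise

/-! ## §3 The full density's canonical version on the window, and the log-odds bounds at one `(J, K)` -/

section Window

variable (F : T3Family) {γ : ℝ} (b₀ p₀ : ℝ) {J K : ℕ} (hJK : J ≤ K)

/-- ★ **THE FULL DENSITY's CANONICAL VERSION IS `Z_K·ρ` ON THE WINDOW** for every continuous positive window version `ρ` of `(D_{J,K})_* Gibbs_K` (VERS ✓`fullVersionConstCan`'s
two-presentation argument, re-run to export the `EqOn`: `withDensity_eq_iff_of_sigmaFinite` on the restricted product Haar, then ✓`Node00.canonVersion_eqOn_of_continuousOn`).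
[cite: Balaban1985UV3, (2) p.256 and (6) p.257; Balaban1987RG1, (0.13) p.254] -/
theorem heightDensityCan_univ_eqOn (hγ : 0 < γ) (ρ : GaugeField (F.P J) 0 (Matrix.specialUnitaryGroup (Fin 2) ℂ) → ℝ)
    (hρpos : ∀ U, PlaqSmall (θBal F.L γ b₀ p₀ J) U → 0 < ρ U)
    (hlaw : Measure.map (descendTo F ℰp J K hJK) (gibbsK F ℰp γ K) =
      (fieldMeasure (F.P J) 0 (Matrix.specialUnitaryGroup (Fin 2) ℂ)).withDensity (fun U => ENNReal.ofReal (ρ U)))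
    (hρc : ContinuousOn ρ {U | PlaqSmall (θBal F.L γ b₀ p₀ J) U}) :
    EqOn (heightDensityCan F γ hJK Set.univ)
      (fun U => partitionFn (G := Matrix.specialUnitaryGroup (Fin 2) ℂ) (F.P K) ((F.scheme ℰp γ).β K) * ρ U)
      {U | PlaqSmall (θBal F.L γ b₀ p₀ J) U} := by
  haveI := B12ContinuousTransportInvariance.isOpenPosMeasure_fieldMeasure_SU (N := 2) (F.P J) 0
  set μ := fieldMeasure (F.P J) 0 (Matrix.specialUnitaryGroup (Fin 2) ℂ) with hμ
  set W : Set (GaugeField (F.P J) 0 (Matrix.specialUnitaryGroup (Fin 2) ℂ)) := {U | PlaqSmall (θBal F.L γ b₀ p₀ J) U} with hW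
  set Z : ℝ := partitionFn (G := Matrix.specialUnitaryGroup (Fin 2) ℂ) (F.P K) ((F.scheme ℰp γ).β K) with hZ
  set hD := heightDensity F γ hJK (Set.univ : Set (GaugeField (F.P K) 0 (Matrix.specialUnitaryGroup (Fin 2) ℂ))) with hhD
  have hZpos : 0 < Z := partitionFn_pos' _ (F.scheme_β_nonneg ℰp hγ.le K)
  have hWo : IsOpen W := isOpen_setOf_plaqSmall₂ (F.P J) 0 _
  have hWm : MeasurableSet W := hWo.measurableSet
  obtain ⟨hDm, -⟩ := heightDensity_props F hJK (S := (Set.univ : Set (GaugeField (F.P K) 0 (Matrix.specialUnitaryGroup (Fin 2) ℂ))))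
    MeasurableSet.univ hγ.le
  have h1 : Measure.map (descendTo F ℰp J K hJK) (gibbsK F ℰp γ K) = μ.withDensity (fun U => ENNReal.ofReal (Z⁻¹ * hD U)) := by
    rw [← Measure.restrict_univ (μ := gibbsK F ℰp γ K)]
    exact map_descendTo_restrict_eq_withDensity F hJK MeasurableSet.univ hγ.le
  have h2 : (μ.restrict W).withDensity (fun U => ENNReal.ofReal (ρ U)) = (μ.restrict W).withDensity (fun U => ENNReal.ofReal (Z⁻¹ * hD U)) := by
    rw [← restrict_withDensity hWm, ← restrict_withDensity hWm, ← hlaw, h1]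
  have hρm : AEMeasurable (fun U => ENNReal.ofReal (ρ U)) (μ.restrict W) := (hρc.aemeasurable hWm).ennreal_ofReal
  have hgm : AEMeasurable (fun U => ENNReal.ofReal (Z⁻¹ * hD U)) (μ.restrict W) := (hDm.const_mul _).ennreal_ofReal.aemeasurable
  have hae : (fun U => ENNReal.ofReal (ρ U)) =ᵐ[μ.restrict W] fun U => ENNReal.ofReal (Z⁻¹ * hD U) :=
    (withDensity_eq_iff_of_sigmaFinite hρm hgm).mp h2
  have hae' : (fun U => Z * ρ U) =ᵐ[μ.restrict W] hD := by
    filter_upwards [hae, ae_restrict_mem hWm] with U hU hUW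
    have hρ0 : 0 ≤ ρ U := (hρpos U hUW).le
    have hg0 : 0 ≤ Z⁻¹ * hD U := mul_nonneg (inv_nonneg.mpr hZpos.le) (heightDensity_nonneg F γ hJK _ U)
    have := (ENNReal.ofReal_eq_ofReal_iff hρ0 hg0).mp hU
    rw [this, ← mul_assoc, mul_inv_cancel₀ hZpos.ne', one_mul]
  have hcont : ContinuousOn (fun U => Z * ρ U) W := continuousOn_const.mul hρc
  exact Node00.canonVersion_eqOn_of_continuousOn hWo hcont hae'

/-- ★★ **THE LOG-ODDS BOUNDS AT ONE `(J, K)`**: COND-ODDS at `(J, K)` with constant `τ` (setwise on the window: `Gibbs_K(D⁻¹B) ≤ e^{τ}·Gibbs_K(D⁻¹B ∩ histGood K J)`),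
a continuous positive window version `ρ` of `(D_{J,K})_* Gibbs_K`, the window inside `regSet(heightDensity^{histGood})` and positivity of `heightDensityCan^{histGood}` there
⟹ with `c := −log Z_K`: `0 ≤ log ρ U − c − log heightDensityCan^{histGood} U ≤ τ` at every window field `U`.  The lower half uses only
`Gibbs(D⁻¹B ∩ hist) ≤ Gibbs(D⁻¹B)`. [cite: Balaban1985UV3, (38)-(40) p.266; Balaban1989LargeFieldII, (1.77)-(1.79) p.383] -/
theorem window_logOdds_bounds (hγ : 0 < γ) {τ : ℝ}
    (hset : ∀ B : Set (GaugeField (F.P J) 0 (Matrix.specialUnitaryGroup (Fin 2) ℂ)), MeasurableSet B →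
      B ⊆ {U | PlaqSmall (θBal F.L γ b₀ p₀ J) U} →
      gibbsK F ℰp γ K (descendTo F ℰp J K hJK ⁻¹' B) ≤
        ENNReal.ofReal (Real.exp τ) * gibbsK F ℰp γ K (descendTo F ℰp J K hJK ⁻¹' B ∩ histGood F ℰp (θBal F.L γ b₀ p₀) K J))
    (ρ : GaugeField (F.P J) 0 (Matrix.specialUnitaryGroup (Fin 2) ℂ) → ℝ)
    (hρpos : ∀ U, PlaqSmall (θBal F.L γ b₀ p₀ J) U → 0 < ρ U)
    (hlaw : Measure.map (descendTo F ℰp J K hJK) (gibbsK F ℰp γ K) =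
      (fieldMeasure (F.P J) 0 (Matrix.specialUnitaryGroup (Fin 2) ℂ)).withDensity (fun U => ENNReal.ofReal (ρ U)))
    (hρc : ContinuousOn ρ {U | PlaqSmall (θBal F.L γ b₀ p₀ J) U})
    (hreg : {U : GaugeField (F.P J) 0 (Matrix.specialUnitaryGroup (Fin 2) ℂ) | PlaqSmall (θBal F.L γ b₀ p₀ J) U} ⊆
      Node00.regSet (fieldMeasure (F.P J) 0 (Matrix.specialUnitaryGroup (Fin 2) ℂ)) (heightDensity F γ hJK (histGood F ℰp (θBal F.L γ b₀ p₀) K J)))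
    (hpos : ∀ U : GaugeField (F.P J) 0 (Matrix.specialUnitaryGroup (Fin 2) ℂ), PlaqSmall (θBal F.L γ b₀ p₀ J) U →
      0 < heightDensityCan F γ hJK (histGood F ℰp (θBal F.L γ b₀ p₀) K J) U) :
    ∀ U : GaugeField (F.P J) 0 (Matrix.specialUnitaryGroup (Fin 2) ℂ), PlaqSmall (θBal F.L γ b₀ p₀ J) U →
      0 ≤ Real.log (ρ U) - (-Real.log (partitionFn (G := Matrix.specialUnitaryGroup (Fin 2) ℂ) (F.P K) ((F.scheme ℰp γ).β K))) -
          Real.log (heightDensityCan F γ hJK (histGood F ℰp (θBal F.L γ b₀ p₀) K J) U) ∧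
      Real.log (ρ U) - (-Real.log (partitionFn (G := Matrix.specialUnitaryGroup (Fin 2) ℂ) (F.P K) ((F.scheme ℰp γ).β K))) -
          Real.log (heightDensityCan F γ hJK (histGood F ℰp (θBal F.L γ b₀ p₀) K J) U) ≤ τ := by
  haveI := B12ContinuousTransportInvariance.isOpenPosMeasure_fieldMeasure_SU (N := 2) (F.P J) 0
  set μ := fieldMeasure (F.P J) 0 (Matrix.specialUnitaryGroup (Fin 2) ℂ) with hμ
  set W : Set (GaugeField (F.P J) 0 (Matrix.specialUnitaryGroup (Fin 2) ℂ)) := {U | PlaqSmall (θBal F.L γ b₀ p₀ J) U} with hW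
  set Z : ℝ := partitionFn (G := Matrix.specialUnitaryGroup (Fin 2) ℂ) (F.P K) ((F.scheme ℰp γ).β K) with hZ
  set G := histGood F ℰp (θBal F.L γ b₀ p₀) K J with hG
  have hZpos : 0 < Z := partitionFn_pos' _ (F.scheme_β_nonneg ℰp hγ.le K)
  have hWo : IsOpen W := isOpen_setOf_plaqSmall₂ (F.P J) 0 _
  have hGm : MeasurableSet G := measurableSet_histGood F ℰp measurableE_ℰp _ K J
  have hD : Measurable (descendTo F ℰp J K hJK) := measurable_descendTo F ℰp measurableE_ℰp hJK
  -- continuity of the two canonical versions on the window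
  have hEq := heightDensityCan_univ_eqOn F b₀ p₀ hJK hγ ρ hρpos hlaw hρc
  have hcU : ContinuousOn (heightDensityCan F γ hJK Set.univ) W := (continuousOn_const.mul hρc).congr hEq
  have hcG : ContinuousOn (heightDensityCan F γ hJK G) W := by
    have : heightDensityCan F γ hJK G = Node00.canonVersion μ (heightDensity F γ hJK G) := rfl
    rw [this]
    exact Node00.continuousOn_canonVersion.mono hreg
  -- upper: univ ≤ e^τ · hist
  have hup : ∀ U ∈ W, heightDensityCan F γ hJK Set.univ U ≤ Real.exp τ * heightDensityCan F γ hJK G U := by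
    refine heightDensityCan_le_of_setwise F hJK hγ MeasurableSet.univ hGm hWo (Real.exp_pos τ).le ?_ hcU hcG
    intro B hB hBW
    rw [Set.inter_univ]
    exact hset B hB hBW
  -- lower: hist ≤ univ (free)
  have hlow : ∀ U ∈ W, heightDensityCan F γ hJK G U ≤ 1 * heightDensityCan F γ hJK Set.univ U := by
    refine heightDensityCan_le_of_setwise F hJK hγ hGm MeasurableSet.univ hWo zero_le_one ?_ hcG hcU
    intro B hB _
    rw [ENNReal.ofReal_one, one_mul, Set.inter_univ]
    exact measure_mono Set.inter_subset_left
  intro U hU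
  have hGpos : 0 < heightDensityCan F γ hJK G U := hpos U hU
  have hρU : 0 < ρ U := hρpos U hU
  have hUpos : 0 < heightDensityCan F γ hJK Set.univ U := lt_of_lt_of_le hGpos (by simpa only [one_mul] using hlow U hU)
  have hlogU : Real.log (ρ U) - (-Real.log Z) = Real.log (heightDensityCan F γ hJK Set.univ U) := by
    rw [hEq hU, Real.log_mul hZpos.ne' hρU.ne']
    ring
  rw [hlogU]
  constructor
  · have := Real.log_le_log hGpos (by simpa only [one_mul] using hlow U hU)
    linarith
  · have h1 : Real.log (heightDensityCan F γ hJK Set.univ U) ≤ Real.log (Real.exp τ * heightDensityCan F γ hJK G U) :=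
      Real.log_le_log hUpos (hup U hU)
    rw [Real.log_mul (Real.exp_pos τ).ne' hGpos.ne', Real.log_exp] at h1
    linarith

end Window

/-! ## §4 THE DOORS: COND-ODDS ⇒ TAILSUP, COND-ODDS at depth one ⇒ TAILSUP₁ (texts of LINE g21-1 verbatim) -/

/-- ★★★ **TAILSUP ⟸ COND-ODDS** (LINE g21-1's `WindowOddsSupCan`, text VERBATIM with `heightDensityCan` = ✓`…WregGlue.heightDensityCan`, so the line closes
`stub_windowOddsSupCan` by `delta`): the hypothesis COND-ODDS is TAILSUP's own quantifier prefix and modulus clause followed by the SETWISE conditional-odds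
inequality `Gibbs_K(D_{J,K}⁻¹B) ≤ e^{τ J}·Gibbs_K(D_{J,K}⁻¹B ∩ histGood K J)` for every measurable `B` inside the window — the probability of a good history given
the window σ-algebra is at least `e^{−τ_J}`, uniformly in the depth.  Inside: ✓`tower_eq_map_descendTo` (the nested law IS `(D_{J,K})_* Gibbs_K`), §3, and WREG
✓`windowRegularity` for the `regSet` clause (thresholds `min γ₁`). [cite: Balaban1985UV3, (38)-(40) p.266; Balaban1989LargeFieldII, (1.77)-(1.79) p.383 and (1.95) p.389] -/
theorem windowOddsSupCan_of_condGoodOdds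
    (h : ∀ (L : ℕ), ∃ pS : ℝ, ∀ (b₀ p₀ : ℝ), 0 < b₀ → pS ≤ p₀ → 0 < p₀ →
      ∃ γ₁ : ℝ, 0 < γ₁ ∧ ∀ (F : T3Family) (γ : ℝ), F.L = L → 0 < γ → γ ≤ γ₁ →
        ∃ τ : ℕ → ℝ, (∀ J, 0 ≤ τ J) ∧ (∀ a : ℕ, Tendsto (fun J : ℕ => ((J : ℝ) + 1) ^ a * τ J) atTop (𝓝 0)) ∧
          ∀ (J K : ℕ) (hJK : J ≤ K) (B : Set (GaugeField (F.P J) 0 (Matrix.specialUnitaryGroup (Fin 2) ℂ))), MeasurableSet B →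
            B ⊆ {U | PlaqSmall (θBal F.L γ b₀ p₀ J) U} →
            gibbsK F ℰp γ K (descendTo F ℰp J K hJK ⁻¹' B) ≤
              ENNReal.ofReal (Real.exp (τ J)) * gibbsK F ℰp γ K (descendTo F ℰp J K hJK ⁻¹' B ∩ histGood F ℰp (θBal F.L γ b₀ p₀) K J)) :
    ∀ (L : ℕ), ∃ pS : ℝ, ∀ (b₀ p₀ : ℝ), 0 < b₀ → pS ≤ p₀ → 0 < p₀ →
      ∃ γ₁ : ℝ, 0 < γ₁ ∧ ∀ (F : T3Family) (γ : ℝ), F.L = L → 0 < γ → γ ≤ γ₁ →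
        ∃ τ : ℕ → ℝ, (∀ J, 0 ≤ τ J) ∧ (∀ a : ℕ, Tendsto (fun J : ℕ => ((J : ℝ) + 1) ^ a * τ J) atTop (𝓝 0)) ∧
          ∀ (ν : ℕ → (j : ℕ) → Measure (GaugeField (F.P j) 0 (Matrix.specialUnitaryGroup (Fin 2) ℂ))),
            (∀ K, ν K K = T4GenFunBounds.gibbsMeasure (F.P K) ((F.scheme ℰp γ).β K)) →
            (∀ K j, j < K → ν K j = Measure.map (descend F ℰp j) (ν K (j + 1))) →
            ∀ (J K : ℕ) (hJK : J ≤ K) (ρ : GaugeField (F.P J) 0 (Matrix.specialUnitaryGroup (Fin 2) ℂ) → ℝ),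
              (∀ U, PlaqSmall (θBal F.L γ b₀ p₀ J) U → 0 < ρ U) →
              ν K J = (fieldMeasure _ _ _).withDensity (fun U => ENNReal.ofReal (ρ U)) →
              ContinuousOn ρ {U | PlaqSmall (θBal F.L γ b₀ p₀ J) U} →
              (∀ U : GaugeField (F.P J) 0 (Matrix.specialUnitaryGroup (Fin 2) ℂ), PlaqSmall (θBal F.L γ b₀ p₀ J) U →
                  0 < heightDensityCan F γ hJK (histGood F ℰp (θBal F.L γ b₀ p₀) K J) U) →
              ∃ c : ℝ, ∀ U : GaugeField (F.P J) 0 (Matrix.specialUnitaryGroup (Fin 2) ℂ), PlaqSmall (θBal F.L γ b₀ p₀ J) U →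
                0 ≤ Real.log (ρ U) - c - Real.log (heightDensityCan F γ hJK (histGood F ℰp (θBal F.L γ b₀ p₀) K J) U) ∧
                Real.log (ρ U) - c - Real.log (heightDensityCan F γ hJK (histGood F ℰp (θBal F.L γ b₀ p₀) K J) U) ≤ τ J := by
  intro L
  obtain ⟨pS, hS⟩ := h L
  refine ⟨pS, fun b₀ p₀ hb₀ hpS hp₀ => ?_⟩
  obtain ⟨γ₁, hγ₁, hF⟩ := hS b₀ p₀ hb₀ hpS hp₀
  obtain ⟨γ₂, hγ₂, hW⟩ := FluctuationComparisonRegPrIntLWreg.windowRegularity L b₀ p₀ hb₀ hp₀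
  refine ⟨min γ₁ γ₂, lt_min hγ₁ hγ₂, fun F γ hFL hγ hγle => ?_⟩
  obtain ⟨τ, hτ0, hτa, hset⟩ := hF F γ hFL hγ (hγle.trans (min_le_left _ _))
  have hW' := hW F γ hFL hγ (hγle.trans (min_le_right _ _))
  refine ⟨τ, hτ0, hτa, fun ν hKK hstep J K hJK ρ hρpos hν hρc hpos => ?_⟩
  have hlaw : Measure.map (descendTo F ℰp J K hJK) (gibbsK F ℰp γ K) =
      (fieldMeasure (F.P J) 0 (Matrix.specialUnitaryGroup (Fin 2) ℂ)).withDensity (fun U => ENNReal.ofReal (ρ U)) := by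
    rw [← tower_eq_map_descendTo F γ ν hKK hstep hJK]
    exact hν
  obtain ⟨hreg, -⟩ := hW' J K hJK γ hγ
  exact ⟨_, window_logOdds_bounds F b₀ p₀ hJK hγ (hset J K hJK) ρ hρpos hlaw hρc hreg hpos⟩

/-- ★★ **TAILSUP₁ ⟸ COND-ODDS AT DEPTH ONE** (LINE g21-1's first rung `WindowOddsSupDepthOneCan`, text VERBATIM): the same door on the runs `K = J + 1` only — the
hypothesis is the setwise conditional-odds inequality for ONE free level, `Gibbs_{J+1}(D_{J,J+1}⁻¹B) ≤ e^{τ J}·Gibbs_{J+1}(D_{J,J+1}⁻¹B ∩ histGood (J+1) J)` (the bad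
history is «some run-`(J+1)` plaquette is `θ(J+1)`-large»: a large deviation of the ONE-STEP constrained fluctuation field).
[cite: Balaban1985UV3, (38)-(40) p.266; Balaban1985Averaging, (10) p.19] -/
theorem windowOddsSupDepthOneCan_of_condGoodOddsDepthOne
    (h : ∀ (L : ℕ), ∃ pS : ℝ, ∀ (b₀ p₀ : ℝ), 0 < b₀ → pS ≤ p₀ → 0 < p₀ →
      ∃ γ₁ : ℝ, 0 < γ₁ ∧ ∀ (F : T3Family) (γ : ℝ), F.L = L → 0 < γ → γ ≤ γ₁ →
        ∃ τ : ℕ → ℝ, (∀ J, 0 ≤ τ J) ∧ (∀ a : ℕ, Tendsto (fun J : ℕ => ((J : ℝ) + 1) ^ a * τ J) atTop (𝓝 0)) ∧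
          ∀ (J : ℕ) (B : Set (GaugeField (F.P J) 0 (Matrix.specialUnitaryGroup (Fin 2) ℂ))), MeasurableSet B →
            B ⊆ {U | PlaqSmall (θBal F.L γ b₀ p₀ J) U} →
            gibbsK F ℰp γ (J + 1) (descendTo F ℰp J (J + 1) (Nat.le_succ J) ⁻¹' B) ≤
              ENNReal.ofReal (Real.exp (τ J)) *
                gibbsK F ℰp γ (J + 1) (descendTo F ℰp J (J + 1) (Nat.le_succ J) ⁻¹' B ∩ histGood F ℰp (θBal F.L γ b₀ p₀) (J + 1) J)) :
    ∀ (L : ℕ), ∃ pS : ℝ, ∀ (b₀ p₀ : ℝ), 0 < b₀ → pS ≤ p₀ → 0 < p₀ →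
      ∃ γ₁ : ℝ, 0 < γ₁ ∧ ∀ (F : T3Family) (γ : ℝ), F.L = L → 0 < γ → γ ≤ γ₁ →
        ∃ τ : ℕ → ℝ, (∀ J, 0 ≤ τ J) ∧ (∀ a : ℕ, Tendsto (fun J : ℕ => ((J : ℝ) + 1) ^ a * τ J) atTop (𝓝 0)) ∧
          ∀ (ν : ℕ → (j : ℕ) → Measure (GaugeField (F.P j) 0 (Matrix.specialUnitaryGroup (Fin 2) ℂ))),
            (∀ K, ν K K = T4GenFunBounds.gibbsMeasure (F.P K) ((F.scheme ℰp γ).β K)) →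
            (∀ K j, j < K → ν K j = Measure.map (descend F ℰp j) (ν K (j + 1))) →
            ∀ (J : ℕ) (ρ : GaugeField (F.P J) 0 (Matrix.specialUnitaryGroup (Fin 2) ℂ) → ℝ),
              (∀ U, PlaqSmall (θBal F.L γ b₀ p₀ J) U → 0 < ρ U) →
              ν (J + 1) J = (fieldMeasure _ _ _).withDensity (fun U => ENNReal.ofReal (ρ U)) →
              ContinuousOn ρ {U | PlaqSmall (θBal F.L γ b₀ p₀ J) U} →
              (∀ U : GaugeField (F.P J) 0 (Matrix.specialUnitaryGroup (Fin 2) ℂ), PlaqSmall (θBal F.L γ b₀ p₀ J) U →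
                  0 < heightDensityCan F γ (Nat.le_succ J) (histGood F ℰp (θBal F.L γ b₀ p₀) (J + 1) J) U) →
              ∃ c : ℝ, ∀ U : GaugeField (F.P J) 0 (Matrix.specialUnitaryGroup (Fin 2) ℂ), PlaqSmall (θBal F.L γ b₀ p₀ J) U →
                0 ≤ Real.log (ρ U) - c - Real.log (heightDensityCan F γ (Nat.le_succ J) (histGood F ℰp (θBal F.L γ b₀ p₀) (J + 1) J) U) ∧
                Real.log (ρ U) - c - Real.log (heightDensityCan F γ (Nat.le_succ J) (histGood F ℰp (θBal F.L γ b₀ p₀) (J + 1) J) U) ≤ τ J := by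
  intro L
  obtain ⟨pS, hS⟩ := h L
  refine ⟨pS, fun b₀ p₀ hb₀ hpS hp₀ => ?_⟩
  obtain ⟨γ₁, hγ₁, hF⟩ := hS b₀ p₀ hb₀ hpS hp₀
  obtain ⟨γ₂, hγ₂, hW⟩ := FluctuationComparisonRegPrIntLWreg.windowRegularity L b₀ p₀ hb₀ hp₀
  refine ⟨min γ₁ γ₂, lt_min hγ₁ hγ₂, fun F γ hFL hγ hγle => ?_⟩
  obtain ⟨τ, hτ0, hτa, hset⟩ := hF F γ hFL hγ (hγle.trans (min_le_left _ _))
  have hW' := hW F γ hFL hγ (hγle.trans (min_le_right _ _))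
  refine ⟨τ, hτ0, hτa, fun ν hKK hstep J ρ hρpos hν hρc hpos => ?_⟩
  have hlaw : Measure.map (descendTo F ℰp J (J + 1) (Nat.le_succ J)) (gibbsK F ℰp γ (J + 1)) =
      (fieldMeasure (F.P J) 0 (Matrix.specialUnitaryGroup (Fin 2) ℂ)).withDensity (fun U => ENNReal.ofReal (ρ U)) := by
    rw [← tower_eq_map_descendTo F γ ν hKK hstep (Nat.le_succ J)]
    exact hν
  obtain ⟨hreg, -⟩ := hW' J (J + 1) (Nat.le_succ J) γ hγ
  exact ⟨_, window_logOdds_bounds F b₀ p₀ (Nat.le_succ J) hγ (hset J) ρ hρpos hlaw hρc hreg hpos⟩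

end Summit.QuantumFields.YangMills.Theorems.FluctuationComparisonRegPrIntLSupTailReduction

end
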